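import Summits.Ventures.WeilGRH.ReflectionBeyondPrelims
import Summits.Ventures.WeilGRH.ReflectionInequalityAt
import HarnessLib

/-!
# GRH arm (rh-explicit, venture WeilGRH): the reflection inequality beyond the shift — core estimate

Window `[-a, a]` with `0 < L ≤ a`, `2a < 3L`: the five sub-intervals
`[-a, a−2L] ∪ [a−2L, L−a] ∪ [L−a, a−L] ∪ [a−L, 2L−a] ∪ [2L−a, a]` are folded onto the PAIR domain
`[a−L, 2L−a]` (points `x`, `x − L`) and the TRIPLE domain `[2L−a, a]` (points `x`, `x − L`, `x − 2L`).
For a test function `g` supported in `[-a, a]`, a unit `ω`, complex `p, r, s` and positive weights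
`B ± κ`, `B`, `d₂`, `d₃`, this file proves the raw estimate `|c|² ≤ W'·G'` (`c = ∫ g cosh(x/2)`) with

`W' = ½[(B+κ)∫|ωg(x)+g(x−L)|² + (B−κ)∫|ωg(x)−g(x−L)|²]_{pairs} + [B∫|u₁|² + d₂∫|u₂|² + d₃∫|u₃|²]_{triples}`,
`G' = ½[∫|ω̄ch(x)+ch(L−x)|²/(B+κ) + ∫|ω̄ch(x)−ch(L−x)|²/(B−κ)]_{pairs} + [∫ch²/B + ∫|ζ₂|²/d₂ + ∫|ζ₃|²/d₃]_{triples}`,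

`u₁ = g(x) + p g(x−L) + r g(x−2L)`, `u₂ = g(x−L) + s g(x−2L)`, `u₃ = g(x−2L)`, `ch(y) = cosh(y/2)`,
`ζ₂ = ch(x−L) − p ch(x)`, `ζ₃ = ch(x−2L) − s ch(x−L) + (ps − r) ch(x)` (the `LDL*` coordinates of
`ReflectionBeyondPrelims`), by the folding identity, the three-term weighted AM–GM and optimisation in the
weight. `ReflectionInequalityBeyond.lean` identifies `W'` with `B‖g‖² + 2κRe(ω k(L)) + 2κ'Re(ω' k(2L))`
under the `LDL*` identities and `G'` with closed forms.

## References

* folklore; H. Yoshida (1992) §6 for the polar bookkeeping.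
-/

noncomputable section

open Complex Filter Set MeasureTheory
open scoped Real Topology ComplexConjugate

namespace Summit.Ventures.WeilGRH

open Literature.NumberTheory.LFunctions

variable {g : ℝ → ℂ}

/-- **Core estimate of the reflection inequality beyond the shift** (see the module docstring). [folklore] -/
theorem reflection_beyond_core (hg : IsWeilTest g) {L a : ℝ} (hsupp : tsupport g ⊆ Icc (-a) a)
    (hL : 0 < L) (hLa : L ≤ a) (h3L : 2 * a < 3 * L) {ω : ℂ} (hω : ‖ω‖ = 1) (p r s : ℂ)
    {κ B d₂ d₃ : ℝ} (hBp : 0 < B + κ) (hBm : 0 < B - κ) (hB : 0 < B) (hd₂ : 0 < d₂) (hd₃ : 0 < d₃)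
    {m' : ℝ} (hm' : m' = 2 * L - a) :
    0 ≤ ((B + κ) * (∫ x in (a - L)..m', ‖ω * g x + g (x - L)‖ ^ 2) +
          (B - κ) * (∫ x in (a - L)..m', ‖ω * g x - g (x - L)‖ ^ 2)) / 2 +
        (B * (∫ x in m'..a, ‖g x + p * g (x - L) + r * g (x - 2 * L)‖ ^ 2) +
          d₂ * (∫ x in m'..a, ‖g (x - L) + s * g (x - 2 * L)‖ ^ 2) +
          d₃ * (∫ x in m'..a, ‖g (x - 2 * L)‖ ^ 2)) ∧
    ‖∫ x, g x * (Real.cosh (x / 2) : ℂ)‖ ^ 2 ≤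
      (((B + κ) * (∫ x in (a - L)..m', ‖ω * g x + g (x - L)‖ ^ 2) +
          (B - κ) * (∫ x in (a - L)..m', ‖ω * g x - g (x - L)‖ ^ 2)) / 2 +
        (B * (∫ x in m'..a, ‖g x + p * g (x - L) + r * g (x - 2 * L)‖ ^ 2) +
          d₂ * (∫ x in m'..a, ‖g (x - L) + s * g (x - 2 * L)‖ ^ 2) +
          d₃ * (∫ x in m'..a, ‖g (x - 2 * L)‖ ^ 2))) *
      (((∫ x in (a - L)..m', ‖conj ω * (Real.cosh (x / 2) : ℂ) + (Real.cosh ((L - x) / 2) : ℂ)‖ ^ 2) /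
            (B + κ) +
          (∫ x in (a - L)..m', ‖conj ω * (Real.cosh (x / 2) : ℂ) - (Real.cosh ((L - x) / 2) : ℂ)‖ ^ 2) /
            (B - κ)) / 2 +
        ((∫ x in m'..a, ‖(Real.cosh (x / 2) : ℂ)‖ ^ 2) / B +
          (∫ x in m'..a, ‖(Real.cosh ((x - L) / 2) : ℂ) - p * (Real.cosh (x / 2) : ℂ)‖ ^ 2) / d₂ +
          (∫ x in m'..a, ‖(Real.cosh ((x - 2 * L) / 2) : ℂ) - s * (Real.cosh ((x - L) / 2) : ℂ) +
            (p * s - r) * (Real.cosh (x / 2) : ℂ)‖ ^ 2) / d₃)) := by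
  -- order of the five break points `-a ≤ a-2L ≤ L-a ≤ a-L ≤ m' ≤ a`
  have ho4 : a - L ≤ m' := by rw [hm']; linarith
  have ho5 : m' ≤ a := by rw [hm']; linarith
  -- support and continuity
  have hgc : Continuous g := hg.1.continuous
  have hz : ∀ x, x ∉ Icc (-a) a → g x = 0 := fun x hx ↦
    image_eq_zero_of_notMem_tsupport fun h ↦ hx (hsupp h)
  have hgL : Continuous fun x ↦ g (x - L) := hgc.comp (continuous_id.sub continuous_const)
  have hg2L : Continuous fun x ↦ g (x - 2 * L) := hgc.comp (continuous_id.sub continuous_const)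
  have hcont_f : Continuous fun x ↦ g x * (Real.cosh (x / 2) : ℂ) := by fun_prop
  have hii : ∀ u v : ℝ, IntervalIntegrable (fun x ↦ g x * (Real.cosh (x / 2) : ℂ)) volume u v :=
    fun u v ↦ hcont_f.intervalIntegrable u v
  -- the reflected pair (pairs) and the LDL coordinates (triples)
  set Ψp : ℝ → ℂ := fun x ↦ ω * g x + g (x - L) with hΨp
  set Ψm : ℝ → ℂ := fun x ↦ ω * g x - g (x - L) with hΨm
  set ηp : ℝ → ℂ := fun x ↦ conj ω * (Real.cosh (x / 2) : ℂ) + (Real.cosh ((L - x) / 2) : ℂ)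
    with hηp
  set ηm : ℝ → ℂ := fun x ↦ conj ω * (Real.cosh (x / 2) : ℂ) - (Real.cosh ((L - x) / 2) : ℂ)
    with hηm
  set u₁ : ℝ → ℂ := fun x ↦ g x + p * g (x - L) + r * g (x - 2 * L) with hu₁
  set u₂ : ℝ → ℂ := fun x ↦ g (x - L) + s * g (x - 2 * L) with hu₂
  set u₃ : ℝ → ℂ := fun x ↦ g (x - 2 * L) with hu₃
  set ζ₁ : ℝ → ℂ := fun x ↦ (Real.cosh (x / 2) : ℂ) with hζ₁
  set ζ₂ : ℝ → ℂ := fun x ↦ (Real.cosh ((x - L) / 2) : ℂ) - p * (Real.cosh (x / 2) : ℂ) with hζ₂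
  set ζ₃ : ℝ → ℂ := fun x ↦ (Real.cosh ((x - 2 * L) / 2) : ℂ) - s * (Real.cosh ((x - L) / 2) : ℂ) +
    (p * s - r) * (Real.cosh (x / 2) : ℂ) with hζ₃
  have hΨpc : Continuous Ψp := by rw [hΨp]; fun_prop
  have hΨmc : Continuous Ψm := by rw [hΨm]; fun_prop
  have hηpc : Continuous ηp := by rw [hηp]; fun_prop
  have hηmc : Continuous ηm := by rw [hηm]; fun_prop
  have hu₁c : Continuous u₁ := by rw [hu₁]; fun_prop
  have hu₂c : Continuous u₂ := by rw [hu₂]; fun_prop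
  have hu₃c : Continuous u₃ := by rw [hu₃]; fun_prop
  have hζ₁c : Continuous ζ₁ := by rw [hζ₁]; fun_prop
  have hζ₂c : Continuous ζ₂ := by rw [hζ₂]; fun_prop
  have hζ₃c : Continuous ζ₃ := by rw [hζ₃]; fun_prop
  -- the real integrals entering `W'` and `G'`
  set Yp : ℝ := ∫ x in (a - L)..m', ‖Ψp x‖ ^ 2 with hYp
  set Ym : ℝ := ∫ x in (a - L)..m', ‖Ψm x‖ ^ 2 with hYm
  set Ep : ℝ := ∫ x in (a - L)..m', ‖ηp x‖ ^ 2 with hEp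
  set Em : ℝ := ∫ x in (a - L)..m', ‖ηm x‖ ^ 2 with hEm
  set U₁ : ℝ := ∫ x in m'..a, ‖u₁ x‖ ^ 2 with hU₁
  set U₂ : ℝ := ∫ x in m'..a, ‖u₂ x‖ ^ 2 with hU₂
  set U₃ : ℝ := ∫ x in m'..a, ‖u₃ x‖ ^ 2 with hU₃
  set Z₁ : ℝ := ∫ x in m'..a, ‖ζ₁ x‖ ^ 2 with hZ₁
  set Z₂ : ℝ := ∫ x in m'..a, ‖ζ₂ x‖ ^ 2 with hZ₂
  set Z₃ : ℝ := ∫ x in m'..a, ‖ζ₃ x‖ ^ 2 with hZ₃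
  have hYp0 : 0 ≤ Yp := intervalIntegral.integral_nonneg ho4 fun x _ ↦ by positivity
  have hYm0 : 0 ≤ Ym := intervalIntegral.integral_nonneg ho4 fun x _ ↦ by positivity
  have hEp0 : 0 ≤ Ep := intervalIntegral.integral_nonneg ho4 fun x _ ↦ by positivity
  have hEm0 : 0 ≤ Em := intervalIntegral.integral_nonneg ho4 fun x _ ↦ by positivity
  have hU₁0 : 0 ≤ U₁ := intervalIntegral.integral_nonneg ho5 fun x _ ↦ by positivity
  have hU₂0 : 0 ≤ U₂ := intervalIntegral.integral_nonneg ho5 fun x _ ↦ by positivity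
  have hU₃0 : 0 ≤ U₃ := intervalIntegral.integral_nonneg ho5 fun x _ ↦ by positivity
  have hZ₁0 : 0 ≤ Z₁ := intervalIntegral.integral_nonneg ho5 fun x _ ↦ by positivity
  have hZ₂0 : 0 ≤ Z₂ := intervalIntegral.integral_nonneg ho5 fun x _ ↦ by positivity
  have hZ₃0 : 0 ≤ Z₃ := intervalIntegral.integral_nonneg ho5 fun x _ ↦ by positivity
  set W : ℝ := ((B + κ) * Yp + (B - κ) * Ym) / 2 + (B * U₁ + d₂ * U₂ + d₃ * U₃) with hW
  set G : ℝ := (Ep / (B + κ) + Em / (B - κ)) / 2 + (Z₁ / B + Z₂ / d₂ + Z₃ / d₃) with hG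
  have hW0 : 0 ≤ W := by
    have h1 : 0 ≤ (B + κ) * Yp := mul_nonneg hBp.le hYp0
    have h2 : 0 ≤ (B - κ) * Ym := mul_nonneg hBm.le hYm0
    have h3 : 0 ≤ B * U₁ := mul_nonneg hB.le hU₁0
    have h4 : 0 ≤ d₂ * U₂ := mul_nonneg hd₂.le hU₂0
    have h5 : 0 ≤ d₃ * U₃ := mul_nonneg hd₃.le hU₃0
    rw [hW]; linarith
  have hG0 : 0 ≤ G := by
    have h1 : 0 ≤ Ep / (B + κ) := div_nonneg hEp0 hBp.le
    have h2 : 0 ≤ Em / (B - κ) := div_nonneg hEm0 hBm.le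
    have h3 : 0 ≤ Z₁ / B := div_nonneg hZ₁0 hB.le
    have h4 : 0 ≤ Z₂ / d₂ := div_nonneg hZ₂0 hd₂.le
    have h5 : 0 ≤ Z₃ / d₃ := div_nonneg hZ₃0 hd₃.le
    rw [hG]; linarith
  /- Step 1: `c = ∫_{a-L}^{m'} (Ψ₊η₊ + Ψ₋η₋)/2 + ∫_{m'}^{a} (u₁ζ₁ + u₂ζ₂ + u₃ζ₃)`. -/
  set c : ℂ := ∫ x, g x * (Real.cosh (x / 2) : ℂ) with hc
  have hc1 : c = ∫ x in (-a)..a, g x * (Real.cosh (x / 2) : ℂ) :=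
    integral_eq_intervalIntegral_of_zero_off (by linarith) fun x hx ↦ by simp [hz x hx]
  have hsplit : c = (∫ x in (-a)..(a - 2 * L), g x * (Real.cosh (x / 2) : ℂ)) +
      ((∫ x in (a - 2 * L)..(L - a), g x * (Real.cosh (x / 2) : ℂ)) +
      ((∫ x in (L - a)..(a - L), g x * (Real.cosh (x / 2) : ℂ)) +
      ((∫ x in (a - L)..m', g x * (Real.cosh (x / 2) : ℂ)) +
        ∫ x in m'..a, g x * (Real.cosh (x / 2) : ℂ)))) := by
    rw [hc1, intervalIntegral.integral_add_adjacent_intervals (hii _ _) (hii _ _),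
      intervalIntegral.integral_add_adjacent_intervals (hii _ _) (hii _ _),
      intervalIntegral.integral_add_adjacent_intervals (hii _ _) (hii _ _),
      intervalIntegral.integral_add_adjacent_intervals (hii _ _) (hii _ _)]
  have hI1 : ∫ x in (-a)..(a - 2 * L), g x * (Real.cosh (x / 2) : ℂ) =
      ∫ x in m'..a, g (x - 2 * L) * (Real.cosh ((x - 2 * L) / 2) : ℂ) := by
    have e := intervalIntegral.integral_comp_sub_right (fun y ↦ g y * (Real.cosh (y / 2) : ℂ)) (2 * L)
      (a := m') (b := a)
    rw [show m' - 2 * L = -a by rw [hm']; ring] at e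
    exact e.symm
  have hI3 : ∫ x in (L - a)..(a - L), g x * (Real.cosh (x / 2) : ℂ) =
      ∫ x in m'..a, g (x - L) * (Real.cosh ((x - L) / 2) : ℂ) := by
    have e := intervalIntegral.integral_comp_sub_right (fun y ↦ g y * (Real.cosh (y / 2) : ℂ)) L
      (a := m') (b := a)
    rw [show m' - L = L - a by rw [hm']; ring] at e
    exact e.symm
  have hI2 : ∫ x in (a - 2 * L)..(L - a), g x * (Real.cosh (x / 2) : ℂ) =
      ∫ x in (a - L)..m', g (x - L) * (Real.cosh ((L - x) / 2) : ℂ) := by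
    have e := intervalIntegral.integral_comp_sub_right (fun y ↦ g y * (Real.cosh (y / 2) : ℂ)) L
      (a := a - L) (b := m')
    rw [show a - L - L = a - 2 * L by ring, show m' - L = L - a by rw [hm']; ring] at e
    rw [← e]
    refine intervalIntegral.integral_congr fun x _ ↦ ?_
    simp only [show (x - L) / 2 = -((L - x) / 2) by ring, Real.cosh_neg]
  have hpair : (∫ x in (a - 2 * L)..(L - a), g x * (Real.cosh (x / 2) : ℂ)) +
      (∫ x in (a - L)..m', g x * (Real.cosh (x / 2) : ℂ)) =
      ∫ x in (a - L)..m', (Ψp x * ηp x + Ψm x * ηm x) / 2 := by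
    rw [hI2, ← intervalIntegral.integral_add ((by fun_prop : Continuous fun x ↦
        g (x - L) * (Real.cosh ((L - x) / 2) : ℂ)).intervalIntegrable _ _) (hii _ _)]
    refine intervalIntegral.integral_congr fun x _ ↦ ?_
    simp only [hΨp, hΨm, hηp, hηm]
    rw [add_comm]
    exact reflectPair_fold hω _ _ _ _
  have htri : (∫ x in (-a)..(a - 2 * L), g x * (Real.cosh (x / 2) : ℂ)) +
      ((∫ x in (L - a)..(a - L), g x * (Real.cosh (x / 2) : ℂ)) +
        ∫ x in m'..a, g x * (Real.cosh (x / 2) : ℂ)) =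
      ∫ x in m'..a, (u₁ x * ζ₁ x + u₂ x * ζ₂ x + u₃ x * ζ₃ x) := by
    have i1 : IntervalIntegrable (fun x ↦ g (x - 2 * L) * (Real.cosh ((x - 2 * L) / 2) : ℂ)) volume m' a :=
      (by fun_prop : Continuous fun x ↦ g (x - 2 * L) * (Real.cosh ((x - 2 * L) / 2) : ℂ)).intervalIntegrable _ _
    have i2 : IntervalIntegrable (fun x ↦ g (x - L) * (Real.cosh ((x - L) / 2) : ℂ)) volume m' a :=
      (by fun_prop : Continuous fun x ↦ g (x - L) * (Real.cosh ((x - L) / 2) : ℂ)).intervalIntegrable _ _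
    rw [hI1, hI3, ← intervalIntegral.integral_add i2 (hii _ _),
      ← intervalIntegral.integral_add i1 (i2.add (hii _ _))]
    refine intervalIntegral.integral_congr fun x _ ↦ ?_
    simp only [hu₁, hu₂, hu₃, hζ₁, hζ₂, hζ₃]
    have := triangle_functional_ldl p r s (Real.cosh (x / 2) : ℂ) (Real.cosh ((x - L) / 2) : ℂ)
      (Real.cosh ((x - 2 * L) / 2) : ℂ) (g x) (g (x - L)) (g (x - 2 * L))
    linear_combination this
  have hc2 : c = (∫ x in (a - L)..m', (Ψp x * ηp x + Ψm x * ηm x) / 2) +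
      ∫ x in m'..a, (u₁ x * ζ₁ x + u₂ x * ζ₂ x + u₃ x * ζ₃ x) := by
    rw [hsplit, ← hpair, ← htri]; ring
  /- Step 2: for every weight `l > 0`, `2|c| ≤ l·W + G/l`. -/
  have key : ∀ l : ℝ, 0 < l → 2 * ‖c‖ ≤ l * W + G / l := by
    intro l hl
    have hμp : 0 < l * (B + κ) := mul_pos hl hBp
    have hμm : 0 < l * (B - κ) := mul_pos hl hBm
    have hμ1 : 0 < l * B := mul_pos hl hB
    have hμ2 : 0 < l * d₂ := mul_pos hl hd₂
    have hμ3 : 0 < l * d₃ := mul_pos hl hd₃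
    -- pairs
    have h2 : ‖∫ x in (a - L)..m', (Ψp x * ηp x + Ψm x * ηm x) / 2‖ ≤
        ∫ x in (a - L)..m', ((l * (B + κ)) * ‖Ψp x‖ ^ 2 + ‖ηp x‖ ^ 2 / (l * (B + κ)) +
          ((l * (B - κ)) * ‖Ψm x‖ ^ 2 + ‖ηm x‖ ^ 2 / (l * (B - κ)))) / 4 := by
      refine (intervalIntegral.norm_integral_le_integral_norm ho4).trans ?_
      refine intervalIntegral.integral_mono_on ho4
        ((by fun_prop : Continuous fun x ↦
          (Ψp x * ηp x + Ψm x * ηm x) / 2).norm.intervalIntegrable _ _)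
        ((by fun_prop : Continuous fun x ↦ ((l * (B + κ)) * ‖Ψp x‖ ^ 2 +
          ‖ηp x‖ ^ 2 / (l * (B + κ)) + ((l * (B - κ)) * ‖Ψm x‖ ^ 2 +
          ‖ηm x‖ ^ 2 / (l * (B - κ)))) / 4).intervalIntegrable _ _) fun x _ ↦ ?_
      have hp := two_mul_le_weighted (u := ‖Ψp x‖) (v := ‖ηp x‖) hμp
      have hq := two_mul_le_weighted (u := ‖Ψm x‖) (v := ‖ηm x‖) hμm
      have hn : ‖(Ψp x * ηp x + Ψm x * ηm x) / 2‖ ≤ (‖Ψp x‖ * ‖ηp x‖ + ‖Ψm x‖ * ‖ηm x‖) / 2 := by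
        rw [norm_div, Complex.norm_two]
        refine div_le_div_of_nonneg_right ?_ (by norm_num)
        exact (norm_add_le _ _).trans (by rw [norm_mul, norm_mul])
      linarith
    have h2' : ∫ x in (a - L)..m', ((l * (B + κ)) * ‖Ψp x‖ ^ 2 + ‖ηp x‖ ^ 2 / (l * (B + κ)) +
          ((l * (B - κ)) * ‖Ψm x‖ ^ 2 + ‖ηm x‖ ^ 2 / (l * (B - κ)))) / 4 =
        ((l * (B + κ)) * Yp + Ep / (l * (B + κ)) + ((l * (B - κ)) * Ym + Em / (l * (B - κ)))) / 4 := by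
      have i1 : IntervalIntegrable (fun x ↦ (l * (B + κ)) * ‖Ψp x‖ ^ 2) volume (a - L) m' :=
        (by fun_prop : Continuous fun x ↦ (l * (B + κ)) * ‖Ψp x‖ ^ 2).intervalIntegrable _ _
      have i2 : IntervalIntegrable (fun x ↦ ‖ηp x‖ ^ 2 / (l * (B + κ))) volume (a - L) m' :=
        (by fun_prop : Continuous fun x ↦ ‖ηp x‖ ^ 2 / (l * (B + κ))).intervalIntegrable _ _
      have i3 : IntervalIntegrable (fun x ↦ (l * (B - κ)) * ‖Ψm x‖ ^ 2) volume (a - L) m' :=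
        (by fun_prop : Continuous fun x ↦ (l * (B - κ)) * ‖Ψm x‖ ^ 2).intervalIntegrable _ _
      have i4 : IntervalIntegrable (fun x ↦ ‖ηm x‖ ^ 2 / (l * (B - κ))) volume (a - L) m' :=
        (by fun_prop : Continuous fun x ↦ ‖ηm x‖ ^ 2 / (l * (B - κ))).intervalIntegrable _ _
      rw [intervalIntegral.integral_div, intervalIntegral.integral_add (i1.add i2) (i3.add i4),
        intervalIntegral.integral_add i1 i2, intervalIntegral.integral_add i3 i4,
        intervalIntegral.integral_const_mul, intervalIntegral.integral_div,
        intervalIntegral.integral_const_mul, intervalIntegral.integral_div]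
    -- triples
    have h3 : ‖∫ x in m'..a, (u₁ x * ζ₁ x + u₂ x * ζ₂ x + u₃ x * ζ₃ x)‖ ≤
        ∫ x in m'..a, ((l * B * ‖u₁ x‖ ^ 2 + ‖ζ₁ x‖ ^ 2 / (l * B)) +
          (l * d₂ * ‖u₂ x‖ ^ 2 + ‖ζ₂ x‖ ^ 2 / (l * d₂)) +
          (l * d₃ * ‖u₃ x‖ ^ 2 + ‖ζ₃ x‖ ^ 2 / (l * d₃))) / 2 := by
      refine (intervalIntegral.norm_integral_le_integral_norm ho5).trans ?_
      exact intervalIntegral.integral_mono_on ho5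
        ((by fun_prop : Continuous fun x ↦
          u₁ x * ζ₁ x + u₂ x * ζ₂ x + u₃ x * ζ₃ x).norm.intervalIntegrable _ _)
        ((by fun_prop : Continuous fun x ↦ ((l * B * ‖u₁ x‖ ^ 2 + ‖ζ₁ x‖ ^ 2 / (l * B)) +
          (l * d₂ * ‖u₂ x‖ ^ 2 + ‖ζ₂ x‖ ^ 2 / (l * d₂)) +
          (l * d₃ * ‖u₃ x‖ ^ 2 + ‖ζ₃ x‖ ^ 2 / (l * d₃))) / 2).intervalIntegrable _ _)
        fun x _ ↦ norm_three_term_le hμ1 hμ2 hμ3 _ _ _ _ _ _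
    have h3' : ∫ x in m'..a, ((l * B * ‖u₁ x‖ ^ 2 + ‖ζ₁ x‖ ^ 2 / (l * B)) +
          (l * d₂ * ‖u₂ x‖ ^ 2 + ‖ζ₂ x‖ ^ 2 / (l * d₂)) +
          (l * d₃ * ‖u₃ x‖ ^ 2 + ‖ζ₃ x‖ ^ 2 / (l * d₃))) / 2 =
        ((l * B * U₁ + Z₁ / (l * B)) + (l * d₂ * U₂ + Z₂ / (l * d₂)) +
          (l * d₃ * U₃ + Z₃ / (l * d₃))) / 2 := by
      have i1 : IntervalIntegrable (fun x ↦ l * B * ‖u₁ x‖ ^ 2) volume m' a :=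
        (by fun_prop : Continuous fun x ↦ l * B * ‖u₁ x‖ ^ 2).intervalIntegrable _ _
      have i2 : IntervalIntegrable (fun x ↦ ‖ζ₁ x‖ ^ 2 / (l * B)) volume m' a :=
        (by fun_prop : Continuous fun x ↦ ‖ζ₁ x‖ ^ 2 / (l * B)).intervalIntegrable _ _
      have i3 : IntervalIntegrable (fun x ↦ l * d₂ * ‖u₂ x‖ ^ 2) volume m' a :=
        (by fun_prop : Continuous fun x ↦ l * d₂ * ‖u₂ x‖ ^ 2).intervalIntegrable _ _
      have i4 : IntervalIntegrable (fun x ↦ ‖ζ₂ x‖ ^ 2 / (l * d₂)) volume m' a :=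
        (by fun_prop : Continuous fun x ↦ ‖ζ₂ x‖ ^ 2 / (l * d₂)).intervalIntegrable _ _
      have i5 : IntervalIntegrable (fun x ↦ l * d₃ * ‖u₃ x‖ ^ 2) volume m' a :=
        (by fun_prop : Continuous fun x ↦ l * d₃ * ‖u₃ x‖ ^ 2).intervalIntegrable _ _
      have i6 : IntervalIntegrable (fun x ↦ ‖ζ₃ x‖ ^ 2 / (l * d₃)) volume m' a :=
        (by fun_prop : Continuous fun x ↦ ‖ζ₃ x‖ ^ 2 / (l * d₃)).intervalIntegrable _ _
      rw [intervalIntegral.integral_div,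
        intervalIntegral.integral_add ((i1.add i2).add (i3.add i4)) (i5.add i6),
        intervalIntegral.integral_add (i1.add i2) (i3.add i4),
        intervalIntegral.integral_add i1 i2, intervalIntegral.integral_add i3 i4,
        intervalIntegral.integral_add i5 i6,
        intervalIntegral.integral_const_mul, intervalIntegral.integral_div,
        intervalIntegral.integral_const_mul, intervalIntegral.integral_div,
        intervalIntegral.integral_const_mul, intervalIntegral.integral_div]
    have hcn : ‖c‖ ≤ ‖∫ x in (a - L)..m', (Ψp x * ηp x + Ψm x * ηm x) / 2‖ +
        ‖∫ x in m'..a, (u₁ x * ζ₁ x + u₂ x * ζ₂ x + u₃ x * ζ₃ x)‖ := by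
      rw [hc2]; exact norm_add_le _ _
    rw [h2'] at h2
    rw [h3'] at h3
    have halg : ((l * (B + κ)) * Yp + Ep / (l * (B + κ)) + ((l * (B - κ)) * Ym + Em / (l * (B - κ)))) / 2 +
        ((l * B * U₁ + Z₁ / (l * B)) + (l * d₂ * U₂ + Z₂ / (l * d₂)) +
          (l * d₃ * U₃ + Z₃ / (l * d₃))) = l * W + G / l := by
      rw [hW, hG]
      field_simp
      ring
    linarith
  /- Step 3: optimise in `l`. -/
  exact ⟨hW0, Literature.Analysis.FluidPDE.Wei2016.sq_le_mul_of_forall_two_mul_le (norm_nonneg _) hW0 hG0 key⟩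

end Summit.Ventures.WeilGRH
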